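import Summits.KontsevichZagierPeriods.KontsevichZagierPeriods.Theorems.HurwitzMicroSectorsNormalFormPrincipleDilogExistsBoxAtoms

/-!
# `NormalFormPrinciple` (stmt-KontsevichZagierPeriods-3869), line `SketchIdeator1` —
# leaf `stub_boxRigidity`, dilogarithm layer: Landen's identity, the Möbius involution

Pure proof file (registered sub-goal `landen_moebius` of the layer `Dilog`, lead seat c9;
`--supports` the crux). LANDEN's identity `Li₂(z) + Li₂(z/(z − 1)) = −½ log²(1 − z)`
(`0 < z < 1`) is, inside the Kontsevich–Zagier calculus, a chain of moves between pieces over the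
open simplex `{0 < t₁ < t₀ < z}` (outer variable `t₀`, inner variable `t₁`):
`A(z) = [{0 < t₁ < t₀ < z}, 1/(t₀(1 − t₁))]` (value `Li₂ z`),
`A'(w) = [{w < t₀ < t₁ < 0}, 1/(t₀(1 − t₁))]` (value `Li₂ w`, `w = z/(z − 1) < 0`), the Möbius
piece `M(z) = [{0 < t₁ < t₀ < z}, −1/(t₀(1 − t₀)(1 − t₁))]` and
`Q(z) = [{0 < t₁ < t₀ < z}, 1/((1 − t₀)(1 − t₁))]`. This file supplies the two moves through the
Möbius piece:

* rule (2), the Möbius involution `μ(s) = s/(s − 1)` on BOTH coordinates,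
  `Φ(t₀, t₁) = (μ t₀, μ t₁)`: `μ` is a strictly decreasing involution of `(−∞, 1)` with `μ 0 = 0`
  and `μ z = w`, so `Φ` maps `{0 < t₁ < t₀ < z}` injectively onto `{w < u₀ < u₁ < 0}`; its
  Jacobian determinant is `1/((t₀ − 1)²(t₁ − 1)²) > 0` and the pull-back identity
  `1/(u₀(1 − u₁)) · 1/((t₀ − 1)²(t₁ − 1)²) = −1/(t₀(1 − t₀)(1 − t₁))` (`u = Φ t`) holds on the
  simplex; hence `[M] − [A']` is ONE change-of-variables move (`lm_moebius_sub_mem_relations`);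
* rule (1b), additivity of the integrand on the common domain:
  `−1/(t₀(1 − t₀)(1 − t₁)) + 1/(t₀(1 − t₁)) + 1/((1 − t₀)(1 − t₁)) = 0` on the simplex, so
  `[M] + [A] + [Q] ∈ KZ.relations` (`lm_moebius_add_add_mem_relations`).

References: M. Kontsevich, D. Zagier, *Periods* (2001), §1.1–1.2, rules (1), (2); L. Lewin,
*Polylogarithms and associated functions* (1981), §1.5 (Landen's identity). No definitions are
introduced.
-/

noncomputable section

open MeasureTheory Set
open Literature.NumberTheory.Transcendental Literature.NumberTheory.Transcendental.KZ
open Literature.ModelTheory.ExponentialFields (IsSemialgebraic)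

namespace Summit.KontsevichZagierPeriods.HurwitzMicroSectors.NormalFormPrinciple.PiBox.Dilog

/-! ## The Möbius involution `μ(s) = s/(s − 1)` of `(−∞, 1)` -/

/-- The Möbius transformation `μ(s) = s/(s − 1)` is an involution away from `s = 1`:
`μ (μ s) = s`. [folklore] -/
theorem lm_moebius_moebius {s : ℝ} (hs : s - 1 ≠ 0) : s / (s - 1) / (s / (s - 1) - 1) = s := by
  have h : s / (s - 1) - 1 = (s - 1)⁻¹ := by
    field_simp
    ring
  rw [h, div_inv_eq_mul, div_mul_cancel₀ s hs]

/-- The Möbius transformation `μ(s) = s/(s − 1)` is strictly decreasing on `(−∞, 1)`. [folklore] -/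
theorem lm_moebius_lt_moebius {a b : ℝ} (hab : a < b) (hb : b < 1) :
    b / (b - 1) < a / (a - 1) := by
  have ha1 : a - 1 < 0 := by linarith
  have hb1 : b - 1 < 0 := by linarith
  have ha1' : a - 1 ≠ 0 := ha1.ne
  have hb1' : b - 1 ≠ 0 := hb1.ne
  have h : a / (a - 1) - b / (b - 1) = (b - a) / ((a - 1) * (b - 1)) := by
    field_simp
    ring
  rw [← sub_pos, h]
  exact div_pos (sub_pos.2 hab) (mul_pos_of_neg_of_neg ha1 hb1)

/-- The Möbius transformation fixes the origin: `μ 0 = 0`. [folklore] -/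
theorem lm_moebius_zero : (0:ℝ) / (0 - 1) = 0 := zero_div _

/-- The derivative of the Möbius transformation: `μ'(s) = −1/(s − 1)²` for `s ≠ 1`. [folklore] -/
theorem lm_hasDerivAt_moebius {s : ℝ} (hs : s - 1 ≠ 0) :
    HasDerivAt (fun y : ℝ => y / (y - 1)) (-1 / (s - 1) ^ 2) s := by
  have h := (hasDerivAt_id' s).fun_div ((hasDerivAt_id' s).sub_const 1) hs
  refine h.congr_deriv ?_
  rw [one_mul, mul_one, sub_sub_cancel_left]

/-- **The pull-back identity** of the Möbius chart (Jacobian `1/((a − 1)²(b − 1)²)` included):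
`−1/(a(1 − a)(1 − b)) = 1/(μ a · (1 − μ b)) · 1/((a − 1)²(b − 1)²)` for `a ≠ 0`, `a, b ≠ 1`.
[folklore] -/
theorem lm_moebius_pullback {a b : ℝ} (ha : a ≠ 0) (ha1 : a - 1 ≠ 0) (hb1 : b - 1 ≠ 0) :
    -1 / (a * (1 - a) * (1 - b)) =
      1 / (a / (a - 1) * (1 - b / (b - 1))) * (1 / ((a - 1) ^ 2 * (b - 1) ^ 2)) := by
  have ha1' : 1 - a ≠ 0 := fun h => ha1 (by linarith)
  have hb1' : 1 - b ≠ 0 := fun h => hb1 (by linarith)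
  have hμb : 1 - b / (b - 1) = -(b - 1)⁻¹ := by
    field_simp
    ring
  rw [hμb]
  field_simp
  ring

/-- **The Möbius chart `Φ(t₀, t₁) = (t₀/(t₀ − 1), t₁/(t₁ − 1))`** of the open simplex
`{0 < t₁ < t₀ < z}` (`z < 1`, `w(z − 1) = z`): a `ℚ`-rational (hence `ℚ`-semialgebraic) map,
differentiable on the simplex with derivative `diag(−1/(t₀ − 1)², −1/(t₁ − 1)²)` of determinant
`1/((t₀ − 1)²(t₁ − 1)²)`, injective (an involution) and ONTO `{w < u₀ < u₁ < 0}` (the Möbius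
transformation is a strictly decreasing involution of `(−∞, 1)` with `0 ↦ 0`, `z ↦ w`).
[folklore] -/
theorem lm_exists_moebiusChart {z w : ℝ} (hz1 : z < 1) (hw : w * (z - 1) = z)
    (hσ : IsSemialgebraic ℚ {t : Fin 2 → ℝ | 0 < t 1 ∧ t 1 < t 0 ∧ t 0 < z}) :
    ∃ (Φ : (Fin 2 → ℝ) → (Fin 2 → ℝ)) (Φ' : (Fin 2 → ℝ) → (Fin 2 → ℝ) →L[ℝ] (Fin 2 → ℝ)),
      (∀ t i, Φ t i = t i / (t i - 1)) ∧
      IsSemialgebraicMapOn ℚ {t : Fin 2 → ℝ | 0 < t 1 ∧ t 1 < t 0 ∧ t 0 < z} Φ ∧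
      (∀ t ∈ {t : Fin 2 → ℝ | 0 < t 1 ∧ t 1 < t 0 ∧ t 0 < z}, HasFDerivAt Φ (Φ' t) t) ∧
      Set.InjOn Φ {t : Fin 2 → ℝ | 0 < t 1 ∧ t 1 < t 0 ∧ t 0 < z} ∧
      Φ '' {t : Fin 2 → ℝ | 0 < t 1 ∧ t 1 < t 0 ∧ t 0 < z} =
        {u : Fin 2 → ℝ | w < u 0 ∧ u 0 < u 1 ∧ u 1 < 0} ∧
      (∀ t ∈ {t : Fin 2 → ℝ | 0 < t 1 ∧ t 1 < t 0 ∧ t 0 < z},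
        |(Φ' t).det| = 1 / ((t 0 - 1) ^ 2 * (t 1 - 1) ^ 2)) := by
  set Φ : (Fin 2 → ℝ) → (Fin 2 → ℝ) := fun t i => t i / (t i - 1)
  set Φ' : (Fin 2 → ℝ) → (Fin 2 → ℝ) →L[ℝ] (Fin 2 → ℝ) := fun t =>
    LinearMap.toContinuousLinearMap
      (Matrix.toLin' (Matrix.diagonal fun i : Fin 2 => -1 / (t i - 1) ^ 2))
  have hΦi : ∀ t i, Φ t i = t i / (t i - 1) := fun t i => rfl
  have hΦ'app : ∀ (t v : Fin 2 → ℝ) (i : Fin 2), Φ' t v i = -1 / (t i - 1) ^ 2 * v i := by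
    intro t v i
    change Matrix.toLin' (Matrix.diagonal fun i : Fin 2 => -1 / (t i - 1) ^ 2) v i = _
    rw [Matrix.toLin'_apply, Matrix.mulVec_diagonal]
  have hdet : ∀ t, (Φ' t).det = 1 / ((t 0 - 1) ^ 2 * (t 1 - 1) ^ 2) := by
    intro t
    change LinearMap.det
      (Matrix.toLin' (Matrix.diagonal fun i : Fin 2 => -1 / (t i - 1) ^ 2)) = _
    rw [LinearMap.det_toLin', Matrix.det_diagonal, Fin.prod_univ_two]
    show -1 / (t 0 - 1) ^ 2 * (-1 / (t 1 - 1) ^ 2) = 1 / ((t 0 - 1) ^ 2 * (t 1 - 1) ^ 2)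
    rw [div_mul_div_comm, neg_mul_neg, one_mul]
  -- the key numbers attached to `z` and `w`
  have hz1' : z - 1 ≠ 0 := sub_ne_zero.2 hz1.ne
  have hwz : z / (z - 1) = w := ((eq_div_iff hz1').2 hw).symm
  have hμw : w / (w - 1) = z := by rw [← hwz]; exact lm_moebius_moebius hz1'
  -- on the simplex both coordinates are `< 1`
  have hlt1 : ∀ t ∈ {t : Fin 2 → ℝ | 0 < t 1 ∧ t 1 < t 0 ∧ t 0 < z}, ∀ i, t i < 1 := by
    intro t ht
    refine Fin.forall_fin_two.mpr ⟨?_, ?_⟩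
    · exact ht.2.2.trans hz1
    · exact (ht.2.1.trans ht.2.2).trans hz1
  have hne1 : ∀ t ∈ {t : Fin 2 → ℝ | 0 < t 1 ∧ t 1 < t 0 ∧ t 0 < z}, ∀ i, t i - 1 ≠ 0 :=
    fun t ht i => sub_ne_zero.2 (hlt1 t ht i).ne
  have hderiv : ∀ t ∈ {t : Fin 2 → ℝ | 0 < t 1 ∧ t 1 < t 0 ∧ t 0 < z},
      HasFDerivAt Φ (Φ' t) t := by
    intro t ht
    rw [hasFDerivAt_pi']
    intro i
    have happ : HasFDerivAt (fun y : Fin 2 → ℝ => y i)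
        (ContinuousLinearMap.proj (R := ℝ) (φ := fun _ : Fin 2 => ℝ) i) t := hasFDerivAt_apply i t
    have hc := (lm_hasDerivAt_moebius (hne1 t ht i)).comp_hasFDerivAt t happ
    have hf :
        (fun x : Fin 2 → ℝ => Φ x i) = (fun y : ℝ => y / (y - 1)) ∘ fun x : Fin 2 → ℝ => x i :=
      rfl
    rw [hf]
    refine hc.congr_fderiv (ContinuousLinearMap.ext fun v => ?_)
    simp only [smul_apply, ContinuousLinearMap.comp_apply, ContinuousLinearMap.proj_apply, hΦ'app,
      smul_eq_mul]
  refine ⟨Φ, Φ', hΦi, ?_, hderiv, ?_, ?_, fun t ht => ?_⟩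
  · -- a `ℚ`-rational map is `ℚ`-semialgebraic
    refine IsSemialgebraicMapOn.of_forall hσ fun j => ?_
    refine (isSemialgebraicFunOn_aeval_div_aeval hσ (MvPolynomial.X j)
      (MvPolynomial.X j - 1 : MvPolynomial (Fin 2) ℚ) fun x hx => ?_).congr fun x _ => ?_
    · simp only [map_sub, MvPolynomial.aeval_X, map_one]
      exact hne1 x hx j
    · simp only [map_sub, MvPolynomial.aeval_X, map_one, hΦi]
  · -- injective on the simplex (the Möbius transformation is an involution)
    intro x hx y hy hxy
    funext i
    have e : x i / (x i - 1) = y i / (y i - 1) := by rw [← hΦi, ← hΦi, hxy]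
    rw [← lm_moebius_moebius (hne1 x hx i), e, lm_moebius_moebius (hne1 y hy i)]
  · -- onto `{w < u₀ < u₁ < 0}`
    ext u
    constructor
    · rintro ⟨t, ht, rfl⟩
      refine ⟨?_, ?_, ?_⟩
      · show w < t 0 / (t 0 - 1)
        rw [← hwz]
        exact lm_moebius_lt_moebius ht.2.2 hz1
      · show t 0 / (t 0 - 1) < t 1 / (t 1 - 1)
        exact lm_moebius_lt_moebius ht.2.1 (hlt1 t ht 0)
      · show t 1 / (t 1 - 1) < 0
        rw [← lm_moebius_zero]
        exact lm_moebius_lt_moebius ht.1 (hlt1 t ht 1)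
    · intro hu
      have hu1 : u 1 < 1 := hu.2.2.trans one_pos
      have hu0 : u 0 < 1 := hu.2.1.trans hu1
      have hui : ∀ i, u i - 1 ≠ 0 :=
        Fin.forall_fin_two.mpr ⟨sub_ne_zero.2 hu0.ne, sub_ne_zero.2 hu1.ne⟩
      have ht : Φ u ∈ {t : Fin 2 → ℝ | 0 < t 1 ∧ t 1 < t 0 ∧ t 0 < z} := by
        refine ⟨?_, ?_, ?_⟩
        · show 0 < u 1 / (u 1 - 1)
          rw [← lm_moebius_zero]
          exact lm_moebius_lt_moebius hu.2.2 one_pos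
        · show u 1 / (u 1 - 1) < u 0 / (u 0 - 1)
          exact lm_moebius_lt_moebius hu.2.1 hu1
        · show u 0 / (u 0 - 1) < z
          rw [← hμw]
          exact lm_moebius_lt_moebius hu.1 hu0
      refine ⟨Φ u, ht, funext fun i => ?_⟩
      rw [hΦi, hΦi]
      exact lm_moebius_moebius (hui i)
  · -- the Jacobian is positive
    rw [hdet]
    have h := mul_pos_of_neg_of_neg (sub_neg.2 (hlt1 t ht 0)) (sub_neg.2 (hlt1 t ht 1))
    rw [← mul_pow]
    exact abs_of_pos (one_div_pos.2 (pow_pos h 2))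

/-! ## Rule (2): the Möbius move `[M] − [A']` -/

/-- **The Möbius move (rule 2).** For `z < 1`, `w(z − 1) = z` and representations
`M = [{0 < t₁ < t₀ < z}, −1/(t₀(1 − t₀)(1 − t₁))]`, `A' = [{w < t₀ < t₁ < 0}, 1/(t₀(1 − t₁))]`
(integrands pinned on the domains only), `[M] − [A']` is ONE change-of-variables move of the
Kontsevich–Zagier calculus along the Möbius chart `Φ(t₀,t₁) = (t₀/(t₀ − 1), t₁/(t₁ − 1))`
(`lm_exists_moebiusChart`); the pull-back identity
`M.integrand t = A'.integrand (Φ t) · |det DΦ(t)|` on the simplex is `lm_moebius_pullback`.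
[cite: KontsevichZagier2001, §1.2 rule (2)] -/
theorem lm_moebius_sub_mem_relations {z w : ℝ} (hz1 : z < 1) (hw : w * (z - 1) = z)
    (M A' : IntegralRep 2)
    (hMd : M.domain = {t | 0 < t 1 ∧ t 1 < t 0 ∧ t 0 < z})
    (hMi : EqOn M.integrand (fun t => -1 / (t 0 * (1 - t 0) * (1 - t 1))) M.domain)
    (hA'd : A'.domain = {t | w < t 0 ∧ t 0 < t 1 ∧ t 1 < 0})
    (hA'i : EqOn A'.integrand (fun t => 1 / (t 0 * (1 - t 1))) A'.domain) :
    of M - of A' ∈ relations := by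
  have hσ : IsSemialgebraic ℚ {t : Fin 2 → ℝ | 0 < t 1 ∧ t 1 < t 0 ∧ t 0 < z} :=
    hMd ▸ M.isSemialgebraic_domain
  obtain ⟨Φ, Φ', hΦi, hsa, hderiv, hinj, himage, hdet⟩ := lm_exists_moebiusChart hz1 hw hσ
  have himage' : A'.domain = Φ '' M.domain := by rw [hMd, himage, hA'd]
  have hsa' : IsSemialgebraicMapOn ℚ M.domain Φ := by rw [hMd]; exact hsa
  have hinj' : InjOn Φ M.domain := by rw [hMd]; exact hinj
  have hderiv' : ∀ x ∈ M.domain, HasFDerivWithinAt Φ (Φ' x) M.domain x :=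
    fun x hx => (hderiv x (by rw [hMd] at hx; exact hx)).hasFDerivWithinAt
  refine changeOfVariablesRel_subset_relations
    ⟨2, M, A', Φ, Φ', hsa', hderiv', hinj', himage', fun x hx => ?_, rfl⟩
  -- the pull-back identity on `M.domain`, Jacobian `|det DΦ| = 1/((t₀ − 1)²(t₁ − 1)²)` included
  have hΦx : Φ x ∈ A'.domain := himage' ▸ mem_image_of_mem _ hx
  have hx' : x ∈ {t : Fin 2 → ℝ | 0 < t 1 ∧ t 1 < t 0 ∧ t 0 < z} := by rw [hMd] at hx; exact hx
  have h0 : x 0 ≠ 0 := (hx'.1.trans hx'.2.1).ne'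
  have h01 : x 0 - 1 ≠ 0 := sub_ne_zero.2 (hx'.2.2.trans hz1).ne
  have h11 : x 1 - 1 ≠ 0 := sub_ne_zero.2 ((hx'.2.1.trans hx'.2.2).trans hz1).ne
  rw [hMi hx, hA'i hΦx, hdet x hx']
  simp only [hΦi]
  exact lm_moebius_pullback h0 h01 h11

/-! ## Rule (1b): the three-term integrand identity `[M] + [A] + [Q]` -/

/-- The partial-fraction identity behind the Möbius piece:
`1/(a(1 − b)) + 1/((1 − a)(1 − b)) = −(−1/(a(1 − a)(1 − b)))` for `a ≠ 0`, `a, b ≠ 1`.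
[folklore] -/
theorem lm_threeTerm_identity {a b : ℝ} (ha : a ≠ 0) (ha1 : 1 - a ≠ 0) (hb1 : 1 - b ≠ 0) :
    1 / (a * (1 - b)) + 1 / ((1 - a) * (1 - b)) = -(-1 / (a * (1 - a) * (1 - b))) := by
  field_simp
  ring

/-- **The three-term relation (rule 1b).** For `z < 1` and representations `M`, `A`, `Q` on the
open simplex `{0 < t₁ < t₀ < z}` with integrands `−1/(t₀(1 − t₀)(1 − t₁))`, `1/(t₀(1 − t₁))`,
`1/((1 − t₀)(1 − t₁))` (pinned on the domain only), `[M] + [A] + [Q] ∈ relations`: the carrier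
`S = [simplex, A.integrand + Q.integrand]` gives the integrand-additivity move `[S] − [A] − [Q]`,
and `[M] + [S]` is a congruence since `S.integrand = −M.integrand` on the simplex
(`lm_threeTerm_identity`, `KZ.of_add_of_mem_relations_of_eqOn_neg`).
[cite: KontsevichZagier2001, §1.2 rule (1)] -/
theorem lm_moebius_add_add_mem_relations {z : ℝ} (hz1 : z < 1) (M A Q : IntegralRep 2)
    (hMd : M.domain = {t | 0 < t 1 ∧ t 1 < t 0 ∧ t 0 < z})
    (hMi : EqOn M.integrand (fun t => -1 / (t 0 * (1 - t 0) * (1 - t 1))) M.domain)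
    (hAd : A.domain = {t | 0 < t 1 ∧ t 1 < t 0 ∧ t 0 < z})
    (hAi : EqOn A.integrand (fun t => 1 / (t 0 * (1 - t 1))) A.domain)
    (hQd : Q.domain = {t | 0 < t 1 ∧ t 1 < t 0 ∧ t 0 < z})
    (hQi : EqOn Q.integrand (fun t => 1 / ((1 - t 0) * (1 - t 1))) Q.domain) :
    of M + of A + of Q ∈ relations := by
  have hQA : Q.domain = A.domain := hQd.trans hAd.symm
  -- the carrier `S = A + Q` on the simplex (integrand additivity needs a carrier)
  let S : IntegralRep 2 :=
    ⟨A.domain, fun t => A.integrand t + Q.integrand t, A.isSemialgebraic_domain,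
      (IsSemialgebraicFunOn.add_holds A.isSemialgebraicFunOn_integrand
        (hQA ▸ Q.isSemialgebraicFunOn_integrand)).congr fun _ _ => rfl,
      A.integrableOn.add (hQA ▸ Q.integrableOn)⟩
  -- `[S] − [A] − [Q]` is an integrand-additivity move
  have e1 : of S - of A - of Q ∈ relations :=
    integrandAddRel_subset_relations ⟨2, S, A, Q, rfl, hQA, fun _ _ => rfl, rfl⟩
  -- `[M] + [S]` is a congruence: the integrands are opposite on the simplex
  have e2 : of M + of S ∈ relations := by
    refine of_add_of_mem_relations_of_eqOn_neg (hAd.trans hMd.symm) fun t ht => ?_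
    have ht' : t ∈ {t : Fin 2 → ℝ | 0 < t 1 ∧ t 1 < t 0 ∧ t 0 < z} := by rw [hMd] at ht; exact ht
    have htA : t ∈ A.domain := by rw [hAd]; exact ht'
    have htQ : t ∈ Q.domain := by rw [hQd]; exact ht'
    have h0 : t 0 ≠ 0 := (ht'.1.trans ht'.2.1).ne'
    have h01 : 1 - t 0 ≠ 0 := sub_ne_zero.2 (hz1.trans' ht'.2.2).ne'
    have h11 : 1 - t 1 ≠ 0 := sub_ne_zero.2 (hz1.trans' (ht'.2.1.trans ht'.2.2)).ne'
    show A.integrand t + Q.integrand t = -M.integrand t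
    rw [hMi ht, hAi htA, hQi htQ]
    exact lm_threeTerm_identity h0 h01 h11
  have e : of M + of A + of Q = (of M + of S) - (of S - of A - of Q) := by abel
  rw [e]
  exact relations.sub_mem e2 e1

/-! ## The registered sub-goal -/

/-- **Stub S5 (`landen_moebius`; registered sub-goal of stmt-KontsevichZagierPeriods-3869, line
`SketchIdeator1`, layer `Dilog`).** Landen's identity inside the Kontsevich–Zagier calculus:
(1) ONE rule-(2) move along the Möbius involution `t ↦ (t₀/(t₀ − 1), t₁/(t₁ − 1))` takes the
Möbius piece `M = [{0 < t₁ < t₀ < z}, −1/(t₀(1 − t₀)(1 − t₁))]` to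
`A' = [{w < t₀ < t₁ < 0}, 1/(t₀(1 − t₁))]`, `w = z/(z − 1)`; (2) ONE rule-(1b) statement
`[M] + [A] + [Q] ∈ relations` on the common domain, since
`−1/(t₀(1 − t₀)(1 − t₁)) + 1/(t₀(1 − t₁)) + 1/((1 − t₀)(1 − t₁)) = 0`.
[cite: KontsevichZagier2001, §1.2 rules (1), (2)] -/
theorem landen_moebius :
    (∀ (z w : ℝ), 0 < z → z < 1 → w * (z - 1) = z → ∀ (M A' : IntegralRep 2),
      M.domain = {t | 0 < t 1 ∧ t 1 < t 0 ∧ t 0 < z} →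
      EqOn M.integrand (fun t => -1 / (t 0 * (1 - t 0) * (1 - t 1))) M.domain →
      A'.domain = {t | w < t 0 ∧ t 0 < t 1 ∧ t 1 < 0} →
      EqOn A'.integrand (fun t => 1 / (t 0 * (1 - t 1))) A'.domain →
      of M - of A' ∈ relations) ∧
    (∀ (z : ℝ), 0 < z → z < 1 → ∀ (M A Q : IntegralRep 2),
      M.domain = {t | 0 < t 1 ∧ t 1 < t 0 ∧ t 0 < z} →
      EqOn M.integrand (fun t => -1 / (t 0 * (1 - t 0) * (1 - t 1))) M.domain →
      A.domain = {t | 0 < t 1 ∧ t 1 < t 0 ∧ t 0 < z} →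
      EqOn A.integrand (fun t => 1 / (t 0 * (1 - t 1))) A.domain →
      Q.domain = {t | 0 < t 1 ∧ t 1 < t 0 ∧ t 0 < z} →
      EqOn Q.integrand (fun t => 1 / ((1 - t 0) * (1 - t 1))) Q.domain →
      of M + of A + of Q ∈ relations) :=
  ⟨fun _ _ _ hz1 hw M A' hMd hMi hA'd hA'i =>
      lm_moebius_sub_mem_relations hz1 hw M A' hMd hMi hA'd hA'i,
    fun _ _ hz1 M A Q hMd hMi hAd hAi hQd hQi =>
      lm_moebius_add_add_mem_relations hz1 M A Q hMd hMi hAd hAi hQd hQi⟩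

end Summit.KontsevichZagierPeriods.HurwitzMicroSectors.NormalFormPrinciple.PiBox.Dilog
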